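import Mathlib
import Literature.Topology.FourManifolds.PlanarAchiralWords
import Summits.SmoothPoincare4.SmoothPoincare4.Theorems.ConvexBisectionPlanarAcyclicBisectionRigidityHelperReachMon
import HarnessLib

/-!
# Crux `ConvexBisection.PlanarAcyclicBisectionRigidity`, line Sketch (v3.0) — helper
# `helper_holeTwist_conj3` and the conjugation table on three holes

Pure algebra on the definitions of `Literature/Topology/FourManifolds/PlanarAchiralWords.lean`
(arc data `ArcData n` of `Mod(D_n, ∂)`, the generators `PGen` — half-twists `σⱼ^{±1}` and round
Dehn twists `T_[a,b]^{±1}` —, `evalWord`, `invWord`, `PlanarCurve.twistWord`), reusing the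
`ArcData` monoid laws of `…StubWalkLow` (sub-namespace `WalkLow`) and the on-the-nose inverse
pairs of `…HelperSeamNG` (`SeamNG.mul_data_inv`, `evalWord_mul_invWord`, `round_u`, `round_perm`).
First brick of the combinatorial stub `stub_walk3` (the level-3 walk for every spelling): the
conjugation action of the framed braid generators on the round twists, in the model, on THREE
holes (sub-namespace `Conj3`).

* HOLE TWISTS ARE PERMUTED (`helper_holeTwist_conj3`, the registered stub):
  `g · T_[j,j] · g⁻¹ = T_[π_g j, π_g j]` for every word `g`.  The generator step is an identity
  valid for ANY arc data `φ` on any number of holes, `φ · T_[k,k] = T_[π_φ k, π_φ k] · φ`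
  (`Conj3.mul_holeTwist`: `T_[k,k]` has `u_k = x_k`, induces the identity of `F_n`, and both sides
  have `u_k = u_k(φ) · x_{π k}`), so no support hypothesis is needed (`Conj3.holeTwist_conj`).
* (T1) THE OUTER TWIST IS CENTRAL (`outerTwist_conj3`): `g · T_[0,2] · g⁻¹ = T_[0,2]` for every
  word `g` supported on the three holes — `T_[0,2]` induces the inner automorphism by
  `Δ = x₀x₁x₂` and has all arc words `Δ`, so it commutes with every arc data fixing `Δ`
  (`Conj3.comm_outer_of_fix`), which every supported generator does (`Conj3.fix_outer_gen`).
* (T2) THE CONJUGATION TABLE (`Conj3.conj_sigma0_T01`, `conj_sigma1_T12`, `conj_sigma1_T01`,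
  `conj_sigma1inv_T01`, `conj_sigma0_T12`, `conj_sigma0inv_T12`), decided by the ENGINE
  (`Conj3.unf3`: `ext'` + `fin_cases` + `simp` computes the arc data of an explicit word, `group`
  compares free-group words).  With the central product `C = T_[0,2] T_[0,0] T_[1,1] T_[2,2]`:
  `σ₀^{±} T_[0,1] σ₀^{∓} = T_[0,1]`, `σ₁^{±} T_[1,2] σ₁^{∓} = T_[1,2]`,
  `σ₁ T_[0,1] σ₁⁻¹ = σ₀⁻¹ T_[1,2] σ₀ = T_[0,1]⁻¹ T_[1,2]⁻¹ C =: T_z` (the twist about the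
  `{0,2}`-curve `z = σ₁(c_[0,1]) = σ₀⁻¹(c_[1,2])`, `Conj3.zTwist_data`: arc data
  `u = (x y z y⁻¹, 1, y⁻¹ x y z)`), and
  `σ₁⁻¹ T_[0,1] σ₁ = σ₀ T_[1,2] σ₀⁻¹ = T_[1,2]⁻¹ T_[0,1]⁻¹ C = T_[0,1] T_z T_[0,1]⁻¹` (the twist about
  the other `{0,2}`-curve `σ₁⁻¹(c_[0,1]) = σ₀(c_[1,2])`).  In the `F₂` shadow (`x = T_[0,1]`,
  `y = T_[1,2]`, centre dropped): `σ₀ : (x, y) ↦ (x, y⁻¹x⁻¹)`, `σ₁ : (x, y) ↦ (x⁻¹y⁻¹, y)`,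
  `T_z ↦ x⁻¹y⁻¹`.
* (T3) THE LANTERN RELATION (`Conj3.lantern3`, `lantern3'`):
  `T_[0,1] · T_z · T_[1,2] = T_[0,2] · T_[0,0] · T_[1,1] · T_[2,2]` on the nose (and its cyclic
  variants), the classical lantern relation of the four-holed sphere (Dehn; Johnson 1979;
  Farb–Margalit, *A Primer on Mapping Class Groups* (2012), Prop. 5.1) — here an identity of
  explicit arc data checked by computation, nothing is cited as a fact.

Uses nothing unproved.
-/

noncomputable section

open Literature.Topology.FourManifolds Literature.Topology.FourManifolds.PlanarWords

-- the prescribed namespace `Summit.<S>.<P>.…` repeats `SmoothPoincare4` (S = P = SmoothPoincare4)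
set_option linter.dupNamespace false

namespace Summit.SmoothPoincare4.SmoothPoincare4.Theorems.PlanarAcyclicBisectionRigidity.Sketch

namespace Conj3

open ArcData PGen FreeGroup WalkLow SeamNG

variable {n : ℕ}

/-! ## Hole twists `T_[k,k]` on any number of holes: `φ · T_[k,k] = T_[π_φ k, π_φ k] · φ` -/

/-- The block word of a single hole is its generator: `x_[k,k] = x_k`. [folklore] -/
theorem blockWord_single (k : Fin n) : blockWord n k.val k.val = of k := by
  unfold blockWord
  have h : ((List.finRange n).filter fun i : Fin n => decide (k.val ≤ i.val ∧ i.val ≤ k.val))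
      = (List.finRange n).filter (· = k) :=
    List.filter_congr fun i _ => by rw [decide_eq_decide, Fin.ext_iff]; omega
  rw [h, List.filter_eq, List.count_eq_one_of_mem (List.nodup_finRange n) (List.mem_finRange k)]
  simp

/-- The arc words of the hole twist `T_[k,k]`: `u_k = x_k`, `u_i = 1` otherwise. [folklore] -/
theorem holeTwist_u (k i : Fin n) :
    (data n (round k.val k.val false)).u i = if i = k then of k else 1 := by
  rw [round_u, ← blockWord_single k]
  by_cases h : i = k
  · subst h; simp
  · rw [if_neg h, if_neg]
    rw [Fin.ext_iff] at h
    omega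

/-- The hole twist `T_[k,k]` induces the identity of `F_n` (`x_k ↦ x_k x_k x_k⁻¹ = x_k`). [folklore] -/
theorem holeTwist_aut (k : Fin n) : (data n (round k.val k.val false)).aut = MonoidHom.id _ := by
  refine FreeGroup.ext_hom _ _ fun i => ?_
  rw [aut_of, round_perm, holeTwist_u, Equiv.Perm.one_apply, MonoidHom.id_apply]
  split_ifs with h
  · subst h; simp
  · simp

/-- THE KEY COMMUTATION: any arc data `φ` carries the hole twist of `k` to the hole twist of
`π_φ k`: `φ · T_[k,k] = T_[π_φ k, π_φ k] · φ` on the nose (both sides have `u_k = u_k(φ) · x_{π k}`,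
`u_i = u_i(φ)` for `i ≠ k`). [folklore] -/
theorem mul_holeTwist (φ : ArcData n) (k : Fin n) :
    mul φ (data n (round k.val k.val false))
      = mul (data n (round (φ.perm k).val (φ.perm k).val false)) φ := by
  refine ext' (by simp [round_perm]) fun i => ?_
  rw [mul_u, mul_u, holeTwist_u, holeTwist_u, holeTwist_aut, round_perm, Equiv.Perm.one_apply,
    MonoidHom.id_apply]
  by_cases h : i = k
  · subst h; simp [aut_of]
  · have h' : φ.perm i ≠ φ.perm k := fun e => h (φ.perm.injective e)
    simp [h, h']

/-- CONJUGATION OF HOLE TWISTS BY ANY WORD: `g · T_[j,j] · g⁻¹ = T_[π_g j, π_g j]` as arc data, on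
any number of holes and without support hypothesis. [folklore] -/
theorem holeTwist_conj (g : List PGen) (j : Fin n) :
    evalWord n (g ++ [round j.val j.val false] ++ invWord g)
      = evalWord n [round ((evalWord n g).perm j).val ((evalWord n g).perm j).val false] := by
  rw [evalWord_append, evalWord_append, evalWord_cons, evalWord_cons, evalWord_nil, mul_one', mul_one',
    mul_holeTwist, mul_assoc', evalWord_mul_invWord, mul_one']

/-! ## Three holes: block words, normal forms of the half-twists, the computation engine -/

/-- The six round block words on three holes. [folklore] -/
theorem blockWord3 : blockWord 3 0 0 = of 0 ∧ blockWord 3 1 1 = of 1 ∧ blockWord 3 2 2 = of 2 ∧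
    blockWord 3 0 1 = of 0 * of 1 ∧ blockWord 3 1 2 = of 1 * of 2 ∧
    blockWord 3 0 2 = of 0 * of 1 * of 2 := by
  simp [blockWord, List.finRange_succ, mul_assoc]

/-- Arc data of the half-twists `σ₀^{±1}`, `σ₁^{±1}` on three holes in normal form (`σⱼ`:
`π = (j j+1)`, `u_j = x_j`; `σⱼ⁻¹`: `u_{j+1} = x_{j+1}⁻¹`; all other arc words `1`). [folklore] -/
theorem data_sigma3 :
    data 3 (sigma 0 false) = ⟨Equiv.swap 0 1, ![of 0, 1, 1]⟩ ∧
    data 3 (sigma 0 true) = ⟨Equiv.swap 0 1, ![1, (of 1)⁻¹, 1]⟩ ∧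
    data 3 (sigma 1 false) = ⟨Equiv.swap 1 2, ![1, of 1, 1]⟩ ∧
    data 3 (sigma 1 true) = ⟨Equiv.swap 1 2, ![1, 1, (of 2)⁻¹]⟩ := by
  refine ⟨?_, ?_, ?_, ?_⟩ <;> refine ext' (by simp [data]) (fun i => ?_) <;> fin_cases i <;> simp [data]

/-- THE ENGINE's unfolding set on three holes (round twists: `π = 1` and their arc words; the block
words; the half-twists in normal form): `simp [unf3, Equiv.swap_apply_def, evalWord_nil]` computes
the arc data of any explicit word and `group` compares free-group words. [folklore] -/
theorem unf3 :
    (∀ (a b : ℕ) (s : Bool), (data 3 (round a b s)).perm = 1) ∧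
    (∀ (a b : ℕ) (s : Bool) (i : Fin 3), (data 3 (round a b s)).u i =
      if a ≤ i.val ∧ i.val ≤ b then (if s then (blockWord 3 a b)⁻¹ else blockWord 3 a b) else 1) ∧
    (blockWord 3 0 0 = of 0 ∧ blockWord 3 1 1 = of 1 ∧ blockWord 3 2 2 = of 2 ∧
      blockWord 3 0 1 = of 0 * of 1 ∧ blockWord 3 1 2 = of 1 * of 2 ∧
      blockWord 3 0 2 = of 0 * of 1 * of 2) ∧
    (data 3 (sigma 0 false) = ⟨Equiv.swap 0 1, ![of 0, 1, 1]⟩ ∧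
      data 3 (sigma 0 true) = ⟨Equiv.swap 0 1, ![1, (of 1)⁻¹, 1]⟩ ∧
      data 3 (sigma 1 false) = ⟨Equiv.swap 1 2, ![1, of 1, 1]⟩ ∧
      data 3 (sigma 1 true) = ⟨Equiv.swap 1 2, ![1, 1, (of 2)⁻¹]⟩) :=
  ⟨fun _ _ _ => rfl, fun _ _ _ _ => rfl, blockWord3, data_sigma3⟩

/-! ## (T1) The outer boundary twist `T_[0,2]` is central in the geometric group on three holes -/

/-- The arc words of `T_[0,2]` are all equal to `Δ = x₀x₁x₂`. [folklore] -/
theorem outer_u (i : Fin 3) : (data 3 (round 0 2 false)).u i = of 0 * of 1 * of 2 := by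
  rw [round_u, if_pos ⟨Nat.zero_le _, by omega⟩, blockWord3.2.2.2.2.2]
  rfl

/-- `T_[0,2]` induces the inner automorphism `w ↦ Δ w Δ⁻¹` of `F₃`. [folklore] -/
theorem outer_aut (w : FreeGroup (Fin 3)) :
    (data 3 (round 0 2 false)).aut w = of 0 * of 1 * of 2 * w * (of 0 * of 1 * of 2)⁻¹ := by
  have h : (data 3 (round 0 2 false)).aut = (MulAut.conj (of 0 * of 1 * of 2 : FreeGroup (Fin 3))).toMonoidHom :=
    FreeGroup.ext_hom _ _ fun i => by simp [outer_u, round_perm, mul_assoc]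
  exact DFunLike.congr_fun h w

/-- CRITERION: arc data whose induced automorphism fixes `Δ = x₀x₁x₂` (the outer boundary) commutes
with the outer twist `T_[0,2]`. [folklore] -/
theorem comm_outer_of_fix (φ : ArcData 3) (h : φ.aut (of 0 * of 1 * of 2) = of 0 * of 1 * of 2) :
    mul φ (data 3 (round 0 2 false)) = mul (data 3 (round 0 2 false)) φ := by
  refine ext' (by simp [round_perm]) fun i => ?_
  rw [mul_u, mul_u, outer_u, round_perm, Equiv.Perm.one_apply, outer_aut, outer_u, h,
    inv_mul_cancel_right]

/-- Every generator supported on the three holes fixes `Δ` (it is a mapping class of `D₃` fixing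
`∂₀`): checked on `σ₀^{±}, σ₁^{±}` and the twelve round twists `T_[a,b]^{±}`, `a ≤ b ≤ 2` (an empty
round block is the identity). [folklore] -/
theorem fix_outer_gen (p : PGen) (hp : p.below 3 = true) :
    (data 3 p).aut (of 0 * of 1 * of 2) = of 0 * of 1 * of 2 := by
  cases p with
  | sigma j s =>
    have hj : j < 2 := by have := hp; simp [PGen.below] at this; omega
    interval_cases j <;> cases s <;> simp [unf3, Equiv.swap_apply_def] <;> group
  | round a b s =>
    have hb : b < 3 := by simpa [PGen.below] using hp
    rcases Nat.lt_or_ge b a with hab | hab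
    · rw [data_round_degenerate a b s hab, aut_one, MonoidHom.id_apply]
    · interval_cases b <;> interval_cases a <;> cases s <;> simp [unf3] <;> group

/-- Every word supported on the three holes fixes `Δ`. [folklore] -/
theorem fix_outer (g : List PGen) (hg : ∀ q ∈ g, q.below 3 = true) :
    (evalWord 3 g).aut (of 0 * of 1 * of 2) = of 0 * of 1 * of 2 := by
  induction g with
  | nil => rw [evalWord_nil, aut_one, MonoidHom.id_apply]
  | cons p g ih =>
    rw [evalWord_cons, WalkLow.aut_mul, MonoidHom.comp_apply, ih fun q hq => hg q (List.mem_cons_of_mem p hq),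
      fix_outer_gen p (hg p List.mem_cons_self)]

/-- The outer twist commutes with every word supported on the three holes. [folklore] -/
theorem evalWord_comm_outer (g : List PGen) (hg : ∀ q ∈ g, q.below 3 = true) :
    mul (evalWord 3 g) (data 3 (round 0 2 false)) = mul (data 3 (round 0 2 false)) (evalWord 3 g) :=
  comm_outer_of_fix _ (fix_outer g hg)

/-! ## (T2) The conjugation table: half-twists acting on the round twists `T_[0,1]`, `T_[1,2]`

All identities are decided by the engine.  With the CENTRAL product
`C := T_[0,2] · T_[0,0] · T_[1,1] · T_[2,2]` of the four boundary twists, the table reads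
`σ₀^{±} T_[0,1] σ₀^{∓} = T_[0,1]`, `σ₁^{±} T_[1,2] σ₁^{∓} = T_[1,2]`,
`σ₁ T_[0,1] σ₁⁻¹ = σ₀⁻¹ T_[1,2] σ₀ = T_[0,1]⁻¹ T_[1,2]⁻¹ C` (the twist `T_z` about the `{0,2}`-curve
`z = σ₁(c_[0,1]) = σ₀⁻¹(c_[1,2])`), `σ₁⁻¹ T_[0,1] σ₁ = σ₀ T_[1,2] σ₀⁻¹ = T_[1,2]⁻¹ T_[0,1]⁻¹ C` (the
twist about the other `{0,2}`-curve `z' = σ₁⁻¹(c_[0,1]) = σ₀(c_[1,2])`, `T_{z'} = T_[0,1] T_z T_[0,1]⁻¹`);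
in the `F₂` shadow (`x = T_[0,1]`, `y = T_[1,2]`, centre dropped): `σ₀ : x ↦ x, y ↦ y⁻¹x⁻¹`,
`σ₁ : x ↦ x⁻¹y⁻¹, y ↦ y`. -/

/-- `σ₀^{±} · T_[0,1] · σ₀^{∓} = T_[0,1]` (the half-twist inside `c_[0,1]` preserves it). [folklore] -/
theorem conj_sigma0_T01 (s : Bool) :
    evalWord 3 [sigma 0 s, round 0 1 false, sigma 0 (!s)] = evalWord 3 [round 0 1 false] := by
  cases s <;> refine ext' (by simp [unf3, evalWord_nil]) (fun i => ?_) <;> fin_cases i <;>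
    simp [unf3, Equiv.swap_apply_def, evalWord_nil] <;> group

/-- `σ₁^{±} · T_[1,2] · σ₁^{∓} = T_[1,2]`. [folklore] -/
theorem conj_sigma1_T12 (s : Bool) :
    evalWord 3 [sigma 1 s, round 1 2 false, sigma 1 (!s)] = evalWord 3 [round 1 2 false] := by
  cases s <;> refine ext' (by simp [unf3, evalWord_nil]) (fun i => ?_) <;> fin_cases i <;>
    simp [unf3, Equiv.swap_apply_def, evalWord_nil] <;> group

/-- `σ₁ · T_[0,1] · σ₁⁻¹ = T_[0,1]⁻¹ · T_[1,2]⁻¹ · T_[0,2] T_[0,0] T_[1,1] T_[2,2]` (`= T_z`). [folklore] -/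
theorem conj_sigma1_T01 :
    evalWord 3 [sigma 1 false, round 0 1 false, sigma 1 true]
      = evalWord 3 [round 0 1 true, round 1 2 true, round 0 2 false, round 0 0 false,
          round 1 1 false, round 2 2 false] := by
  refine ext' (by simp [unf3, evalWord_nil]) (fun i => ?_)
  fin_cases i <;> simp [unf3, Equiv.swap_apply_def, evalWord_nil] <;> group

/-- `σ₁⁻¹ · T_[0,1] · σ₁ = T_[1,2]⁻¹ · T_[0,1]⁻¹ · T_[0,2] T_[0,0] T_[1,1] T_[2,2]` (`= T_{z'}`). [folklore] -/
theorem conj_sigma1inv_T01 :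
    evalWord 3 [sigma 1 true, round 0 1 false, sigma 1 false]
      = evalWord 3 [round 1 2 true, round 0 1 true, round 0 2 false, round 0 0 false,
          round 1 1 false, round 2 2 false] := by
  refine ext' (by simp [unf3, evalWord_nil]) (fun i => ?_)
  fin_cases i <;> simp [unf3, Equiv.swap_apply_def, evalWord_nil] <;> group

/-- `σ₀ · T_[1,2] · σ₀⁻¹ = T_[1,2]⁻¹ · T_[0,1]⁻¹ · T_[0,2] T_[0,0] T_[1,1] T_[2,2]` (`= T_{z'}`). [folklore] -/
theorem conj_sigma0_T12 :
    evalWord 3 [sigma 0 false, round 1 2 false, sigma 0 true]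
      = evalWord 3 [round 1 2 true, round 0 1 true, round 0 2 false, round 0 0 false,
          round 1 1 false, round 2 2 false] := by
  refine ext' (by simp [unf3, evalWord_nil]) (fun i => ?_)
  fin_cases i <;> simp [unf3, Equiv.swap_apply_def, evalWord_nil] <;> group

/-- `σ₀⁻¹ · T_[1,2] · σ₀ = T_[0,1]⁻¹ · T_[1,2]⁻¹ · T_[0,2] T_[0,0] T_[1,1] T_[2,2]` (`= T_z`). [folklore] -/
theorem conj_sigma0inv_T12 :
    evalWord 3 [sigma 0 true, round 1 2 false, sigma 0 false]
      = evalWord 3 [round 0 1 true, round 1 2 true, round 0 2 false, round 0 0 false,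
          round 1 1 false, round 2 2 false] := by
  refine ext' (by simp [unf3, evalWord_nil]) (fun i => ?_)
  fin_cases i <;> simp [unf3, Equiv.swap_apply_def, evalWord_nil] <;> group

/-- The model satisfies the BRAID RELATION `σ₀σ₁σ₀ = σ₁σ₀σ₁` on three holes. [folklore] -/
theorem braid3 : evalWord 3 [sigma 0 false, sigma 1 false, sigma 0 false]
    = evalWord 3 [sigma 1 false, sigma 0 false, sigma 1 false] := by
  refine ext' (by simp [unf3, evalWord_nil]; decide) (fun i => ?_)
  fin_cases i <;> simp [unf3, Equiv.swap_apply_def, evalWord_nil]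

/-- The PANTS RELATIONS `σ₀² = T_[0,1] T_[0,0]⁻¹ T_[1,1]⁻¹`, `σ₁² = T_[1,2] T_[1,1]⁻¹ T_[2,2]⁻¹` on three
holes (the pure braids `σ₀², σ₁²` are `T_[0,1], T_[1,2]` modulo boundary twists). [folklore] -/
theorem sigma_sq :
    evalWord 3 [sigma 0 false, sigma 0 false] = evalWord 3 [round 0 1 false, round 0 0 true, round 1 1 true] ∧
    evalWord 3 [sigma 1 false, sigma 1 false] = evalWord 3 [round 1 2 false, round 1 1 true, round 2 2 true] := by
  constructor <;> refine ext' (by simp [unf3, evalWord_nil]) (fun i => ?_) <;> fin_cases i <;>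
    simp [unf3, Equiv.swap_apply_def, evalWord_nil] <;> group

/-! ## (T3) The `{0,2}`-twist `T_z` and the lantern relation -/

/-- THE FIXED `{0,2}`-TWIST `T_z := σ₁ · T_[0,1] · σ₁⁻¹`, the positive Dehn twist about the curve
`z = σ₁(c_[0,1])` enclosing the holes `0` and `2`, is the positive twist of the planar curve
`⟨0, 1, [σ₁]⟩` (definitional). [folklore] -/
theorem zTwist_eq_twistWord : evalWord 3 [sigma 1 false, round 0 1 false, sigma 1 true]
    = evalWord 3 ((⟨0, 1, [PGen.sigma 1 false]⟩ : PlanarCurve).twistWord true) := rfl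

/-- The arc data of `T_z`: `π = 1`, `u₀ = x y z y⁻¹`, `u₁ = 1`, `u₂ = y⁻¹ x y z` (the class of `z` is
`x · y z y⁻¹`). [folklore] -/
theorem zTwist_data : (evalWord 3 [sigma 1 false, round 0 1 false, sigma 1 true]).perm = 1 ∧
    (evalWord 3 [sigma 1 false, round 0 1 false, sigma 1 true]).u 0 = of 0 * of 1 * of 2 * (of 1)⁻¹ ∧
    (evalWord 3 [sigma 1 false, round 0 1 false, sigma 1 true]).u 1 = 1 ∧
    (evalWord 3 [sigma 1 false, round 0 1 false, sigma 1 true]).u 2 = (of 1)⁻¹ * of 0 * of 1 * of 2 := by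
  refine ⟨by simp [unf3, evalWord_nil], ?_, ?_, ?_⟩ <;>
    simp [unf3, Equiv.swap_apply_def, evalWord_nil] <;> group

/-- The SAME curve from the other side: `σ₁(c_[0,1]) = σ₀⁻¹(c_[1,2])`, i.e.
`T_z = σ₀⁻¹ · T_[1,2] · σ₀`. [folklore] -/
theorem zTwist_eq_sigma0inv : evalWord 3 [sigma 1 false, round 0 1 false, sigma 1 true]
    = evalWord 3 [sigma 0 true, round 1 2 false, sigma 0 false] :=
  conj_sigma1_T01.trans conj_sigma0inv_T12.symm

/-- **(T3) THE LANTERN RELATION on `D₃` in the arc-data model**: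
`T_[0,1] · T_z · T_[1,2] = T_[0,2] · T_[0,0] · T_[1,1] · T_[2,2]` with `T_z = σ₁ T_[0,1] σ₁⁻¹`
(equivalently, the right-hand side being central, `T_[1,2] T_[0,1] T_z = T_z T_[1,2] T_[0,1] = C`).
[folklore] -/
theorem lantern3 :
    evalWord 3 [round 0 1 false, sigma 1 false, round 0 1 false, sigma 1 true, round 1 2 false]
      = evalWord 3 [round 0 2 false, round 0 0 false, round 1 1 false, round 2 2 false] := by
  refine ext' (by simp [unf3, evalWord_nil]) (fun i => ?_)
  fin_cases i <;> simp [unf3, Equiv.swap_apply_def, evalWord_nil] <;> group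

/-- The lantern relation in the two other cyclic orders. [folklore] -/
theorem lantern3' :
    evalWord 3 [round 1 2 false, round 0 1 false, sigma 1 false, round 0 1 false, sigma 1 true]
      = evalWord 3 [round 0 2 false, round 0 0 false, round 1 1 false, round 2 2 false] ∧
    evalWord 3 [sigma 1 false, round 0 1 false, sigma 1 true, round 1 2 false, round 0 1 false]
      = evalWord 3 [round 0 2 false, round 0 0 false, round 1 1 false, round 2 2 false] := by
  constructor <;> refine ext' (by simp [unf3, evalWord_nil]) (fun i => ?_) <;>
    fin_cases i <;> simp [unf3, Equiv.swap_apply_def, evalWord_nil] <;> group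

end Conj3

open ArcData PGen WalkLow SeamNG in
/-- **Helper `helper_holeTwist_conj3` (line Sketch v3.0, first brick of `stub_walk3`) — conjugating
a hole twist by a geometric word permutes the hole.**  For every word `g` in the generators of the
framed braid group of the disc with three holes and every hole `j`,
`g · T_[j,j] · g⁻¹ = T_[π_g j, π_g j]` as arc data.  Induction on `g`; the generator step is the
on-the-nose commutation `φ · T_[k,k] = T_[π_φ k, π_φ k] · φ` (`Conj3.mul_holeTwist`, valid for ANY
arc data `φ`, so the support hypothesis is in fact not needed: `Conj3.holeTwist_conj`) and the
inverse pair `p · p⁻¹ = 1` (`SeamNG.mul_data_inv`). [folklore] -/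
theorem helper_holeTwist_conj3 (g : List PGen) (hg : ∀ q ∈ g, q.below 3 = true) (j : Fin 3) :
    evalWord 3 (g ++ [PGen.round j.val j.val false] ++ invWord g)
      = evalWord 3 [PGen.round ((evalWord 3 g).perm j).val ((evalWord 3 g).perm j).val false] := by
  induction g with
  | nil => rfl
  | cons p g ih =>
    have ih' := ih fun q hq => hg q (List.mem_cons_of_mem p hq)
    calc evalWord 3 (p :: g ++ [PGen.round j.val j.val false] ++ invWord (p :: g))
        = mul (mul (data 3 p) (evalWord 3 (g ++ [PGen.round j.val j.val false] ++ invWord g)))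
            (data 3 p.inv) := by
          simp only [List.cons_append, invWord_cons, evalWord_append, evalWord_cons, evalWord_nil,
            mul_one', mul_assoc']
      _ = evalWord 3 [PGen.round ((evalWord 3 (p :: g)).perm j).val
            ((evalWord 3 (p :: g)).perm j).val false] := by
          rw [ih', evalWord_cons, evalWord_nil, mul_one', Conj3.mul_holeTwist, mul_assoc', mul_data_inv,
            evalWord_cons, mul_one', evalWord_nil, mul_one', evalWord_cons, mul_perm, Equiv.Perm.mul_apply]

open ArcData PGen WalkLow SeamNG in
/-- **(T1) `outerTwist_conj3` — THE OUTER TWIST IS CENTRAL in the geometric group on three holes.**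
For every word `g` in `σ₀^{±}, σ₁^{±}` and the round twists `T_[a,b]^{±}` (`b < 3`),
`g · T_[0,2] · g⁻¹ = T_[0,2]` as arc data: `T_[0,2]` acts on `F₃` by the inner automorphism of
`Δ = x₀x₁x₂` with all arc words `Δ`, so it commutes with every arc data fixing `Δ`
(`Conj3.comm_outer_of_fix`), and every supported generator fixes `Δ` (`Conj3.fix_outer_gen`). [folklore] -/
theorem outerTwist_conj3 (g : List PGen) (hg : ∀ q ∈ g, q.below 3 = true) :
    evalWord 3 (g ++ [PGen.round 0 2 false] ++ invWord g) = evalWord 3 [PGen.round 0 2 false] := by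
  rw [evalWord_append, evalWord_append, evalWord_cons, evalWord_nil, mul_one',
    Conj3.evalWord_comm_outer g hg, mul_assoc', evalWord_mul_invWord, mul_one']

end Summit.SmoothPoincare4.SmoothPoincare4.Theorems.PlanarAcyclicBisectionRigidity.Sketch

end
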